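import Summits.QuantumFields.GaugeBoot.LoopEquationManySpectators
import Summits.QuantumFields.GaugeBoot.LoopEquationInstances
import HarnessLib

/-!
# The single-link loop equation with ANY NUMBER OF SPECTATOR LOOPS (multi-trace form) (gauge-boot, Lean layer, ADDENDUM 25 part A, file 2/2)

HONEST FRAMING (cell `pub-gaugeboot`, page 1 of every file): the venture produces certified bounds
on lattice expectations at stated coupling, gauge group, dimension and torus size; NOT a mass gap,
NOT a continuum limit, NOT a string tension; NOT Yang–Mills-summit-bearing (barriers
`FixedCouplingUltralocality`, `PerturbativeInvisibility`).  This file enters no number: it is the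
exact Schwinger–Dyson identity behind ALL multi-trace rows of the finite-`N` bootstrap.

## Content

Assembly of the many-spectator pair identity of `LoopEquationManySpectators.lean` over the matrix units
`E_ij − (s/N)δ_ij` (`SU(N)`: `s = 1`; `U(N)`: `s = 0`):

* ★★★ `loopEquationMany_of_sdPairMany` — for `w` closed at `x`, spectators `(x_a, v_a)_{a∈ι}`, multiplier `g` ignoring
  the link, every real `β`, every `d` and every torus side `L`:
  `Σ_k E[splitTerm_k(w)·Π_a tr hol v_a·g] + Σ_a Σ_{k'} E[(Π_{b≠a} tr hol v_b)·mergeTerm_{k'}(w, v_a)·g]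
   + (β/2)·Σ_{ν≠μ,ε} E[plaqTerm_{ν,ε}(w)·Π_a tr hol v_a·g] = 0`
  — Kazakov–Zheng's general multi-trace Makeenko–Migdal equation at finite `N` (arXiv:2404.16925 §2.3) as an
  unconditional theorem on the finite torus; `loopEquationMany_specialUnitaryGroup` / `_unitaryGroup`.
With `ι` empty it is the single-loop equation with a multiplier (`LoopEquationMultiplier`), with one spectator the
two-word equation (`LoopEquationTwoWords`); with TWO spectators that both read the marked link it supplies the missing
third-level rows for the cubic moments of the plaquette at every `N` (`StrongCouplingTriplePlaquette`, ADDENDUM 25: the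
second strong-coupling coefficient of the `SU(N)` plaquette vanishes for `N ≥ 4`).

References: V. Kazakov, Z. Zheng, arXiv:2404.16925 §2.3; P. Anderson, M. Kruczenski, Nucl. Phys. B 921 (2017) §2;
S. Chatterjee, arXiv:1502.07719 §3.  Everything is `[folklore]` given the tree's Schwinger–Dyson identity.
-/

noncomputable section

open MeasureTheory Filter Topology NormedSpace
open scoped Matrix.Norms.Frobenius Matrix
open Literature.MathematicalPhysics.QuantumFieldTheory
open Summit.QuantumFields.YangMills.Cruxes.CurvatureAmnesia.WardDefect.SchwingerDyson

namespace Summit.QuantumFields.GaugeBoot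

variable {d L N : ℕ} {G : Type} [Group G] {ρ : G →* Matrix (Fin N) (Fin N) ℂ}
variable {ι : Type} [Fintype ι] [DecidableEq ι]

/-! ## The multi-spectator loop equation -/

section Assembly

variable [TopologicalSpace G] [IsTopologicalGroup G] [CompactSpace G] [MeasurableSpace G] [BorelSpace G]
  (r : LatticeRep G)

/-- ★★★ **THE SINGLE-LINK LOOP EQUATION WITH A FINITE FAMILY OF SPECTATOR LOOPS (abstract form).**  Let `G` be compact
with lattice representation `r`, `β` real, `e = (x, μ)` an edge of `(ℤ/L)^d`, `w` a word CLOSED at `x`, `(v_a)_{a∈ι}`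
spectator words read from `x_a`, `g` a continuous multiplier, and `s ∈ ℂ` a weight such that every direction
`X_ij = E_ij − (s/N)δ_ij·1` satisfies `SDPairMany` (true for `g` ignoring `e` when `s = 1`, `G = SU(N)`, or `s = 0`,
`G = U(N)`).  Then
`Σ_k E[splitTerm_k(w)·Π_a tr hol v_a·g] + Σ_a Σ_{k'} E[(Π_{b≠a} tr hol v_b)·mergeTerm_{k'}(w, v_a)·g]
 + (β/2)·Σ_{ν≠μ} Σ_ε E[plaqTerm_{ν,ε}(w)·Π_a tr hol v_a·g] = 0`
— Kazakov–Zheng's general multi-trace Makeenko–Migdal equation (arXiv:2404.16925 §2.3) as a theorem about the finite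
torus. [folklore] -/
theorem loopEquationMany_of_sdPairMany [NeZero L] (β : ℝ) (x : Site d L) (μ : Fin d) (s : ℂ) (w : Word d)
    (hw : Word.endpoint x w = x) (xs : ι → Site d L) (vs : ι → Word d) {g : GaugeConfig d L G → ℂ} (hg : Continuous g)
    (hP : ∀ i j : Fin r.N, SDPairMany r β x μ x w xs vs g (unitDir s i j)) :
    (∑ k ∈ Finset.range w.length, ∫ U, splitTerm r.ρ s x μ U w k *
        ((∏ a, (r.ρ (wordHolonomy U (xs a) (vs a))).trace) * g U) ∂(wilsonMeasure (d := d) (L := L) r.ρ β)) +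
      (∑ a, ∑ k ∈ Finset.range (vs a).length,
        ∫ U, (∏ b ∈ Finset.univ.erase a, (r.ρ (wordHolonomy U (xs b) (vs b))).trace) *
          mergeTerm r.ρ s x μ U w (xs a) (vs a) k * g U ∂(wilsonMeasure (d := d) (L := L) r.ρ β)) +
      (β / 2 : ℂ) * ∑ ν ∈ Finset.univ.erase μ, ∑ ε : Bool,
        ∫ U, plaqTerm r.ρ s x μ U w ν ε * ((∏ a, (r.ρ (wordHolonomy U (xs a) (vs a))).trace) * g U)
          ∂(wilsonMeasure (d := d) (L := L) r.ρ β) = 0 := by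
  set μW := wilsonMeasure (d := d) (L := L) r.ρ β with hμW
  have hcP : Continuous fun U : GaugeConfig d L G => ∏ a, (r.ρ (wordHolonomy U (xs a) (vs a))).trace :=
    continuous_finsetProd _ fun a _ => continuous_trace_wordHolonomy r (xs a) (vs a)
  have hcPe : ∀ a, Continuous fun U : GaugeConfig d L G =>
      ∏ b ∈ Finset.univ.erase a, (r.ρ (wordHolonomy U (xs b) (vs b))).trace :=
    fun a => continuous_finsetProd _ fun b _ => continuous_trace_wordHolonomy r (xs b) (vs b)
  have hf : ∀ i j : Fin r.N, Integrable (fun U =>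
      ((Matrix.single j i (1 : ℂ) * insDeriv r.ρ (x, μ) (unitDir s i j) U x w).trace *
          (∏ a, (r.ρ (wordHolonomy U (xs a) (vs a))).trace) +
        (Matrix.single j i (1 : ℂ) * r.ρ (wordHolonomy U x w)).trace *
          ∑ a, (∏ b ∈ Finset.univ.erase a, (r.ρ (wordHolonomy U (xs b) (vs b))).trace) *
            (insDeriv r.ρ (x, μ) (unitDir s i j) U (xs a) (vs a)).trace) * g U) μW :=
    fun i j => integrable_of_continuous r β (continuous_lhsMany r _ _ x μ x w xs vs hg)
  have hg' : ∀ i j : Fin r.N, Integrable (fun U => (Matrix.single j i (1 : ℂ) * r.ρ (wordHolonomy U x w)).trace *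
      (∏ a, (r.ρ (wordHolonomy U (xs a) (vs a))).trace) * g U * (-(1 / 2) * plaqIns r.ρ (unitDir s i j) U x μ)) μW :=
    fun i j => integrable_of_continuous r β (continuous_rhsMany r _ _ x μ x w xs vs hg)
  -- pointwise: the contracted left side
  have hL : ∀ U : GaugeConfig d L G, ∑ i : Fin r.N, ∑ j : Fin r.N,
      ((Matrix.single j i (1 : ℂ) * insDeriv r.ρ (x, μ) (unitDir s i j) U x w).trace *
          (∏ a, (r.ρ (wordHolonomy U (xs a) (vs a))).trace) +
        (Matrix.single j i (1 : ℂ) * r.ρ (wordHolonomy U x w)).trace *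
          ∑ a, (∏ b ∈ Finset.univ.erase a, (r.ρ (wordHolonomy U (xs b) (vs b))).trace) *
            (insDeriv r.ρ (x, μ) (unitDir s i j) U (xs a) (vs a)).trace) * g U =
      (∑ k ∈ Finset.range w.length, splitTerm r.ρ s x μ U w k) *
          ((∏ a, (r.ρ (wordHolonomy U (xs a) (vs a))).trace) * g U) +
        (∑ a, (∏ b ∈ Finset.univ.erase a, (r.ρ (wordHolonomy U (xs b) (vs b))).trace) *
          ∑ k ∈ Finset.range (vs a).length, mergeTerm r.ρ s x μ U w (xs a) (vs a) k) * g U := by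
    intro U
    rw [← sum_trace_insDeriv_unitDir s x μ U w, ← sum_trace_mul_sum_prod_insDeriv_unitDir s x μ U w xs vs]
    simp only [Finset.sum_mul, ← Finset.sum_add_distrib]
    exact Finset.sum_congr rfl fun i _ => Finset.sum_congr rfl fun j _ => by ring
  -- pointwise: the contracted right side
  have hR : ∀ U : GaugeConfig d L G, ∑ i : Fin r.N, ∑ j : Fin r.N,
      (Matrix.single j i (1 : ℂ) * r.ρ (wordHolonomy U x w)).trace *
        (∏ a, (r.ρ (wordHolonomy U (xs a) (vs a))).trace) * g U * (-(1 / 2) * plaqIns r.ρ (unitDir s i j) U x μ) =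
      (-(1 / 2) * ∑ ν ∈ Finset.univ.erase μ, ∑ ε : Bool, plaqTerm r.ρ s x μ U w ν ε) *
        ((∏ a, (r.ρ (wordHolonomy U (xs a) (vs a))).trace) * g U) := by
    intro U
    rw [← sum_trace_mul_plaqIns_unitDir s x μ U w hw, Finset.sum_mul]
    refine Finset.sum_congr rfl fun i _ => ?_
    rw [Finset.sum_mul]
    exact Finset.sum_congr rfl fun j _ => by ring
  -- integrate the contracted identity
  have hsum : ∫ U, ((∑ k ∈ Finset.range w.length, splitTerm r.ρ s x μ U w k) *
        ((∏ a, (r.ρ (wordHolonomy U (xs a) (vs a))).trace) * g U) +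
      (∑ a, (∏ b ∈ Finset.univ.erase a, (r.ρ (wordHolonomy U (xs b) (vs b))).trace) *
        ∑ k ∈ Finset.range (vs a).length, mergeTerm r.ρ s x μ U w (xs a) (vs a) k) * g U) ∂μW =
      (β : ℂ) * ∫ U, (-(1 / 2) * ∑ ν ∈ Finset.univ.erase μ, ∑ ε : Bool, plaqTerm r.ρ s x μ U w ν ε) *
        ((∏ a, (r.ρ (wordHolonomy U (xs a) (vs a))).trace) * g U) ∂μW := by
    calc ∫ U, ((∑ k ∈ Finset.range w.length, splitTerm r.ρ s x μ U w k) *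
          ((∏ a, (r.ρ (wordHolonomy U (xs a) (vs a))).trace) * g U) +
        (∑ a, (∏ b ∈ Finset.univ.erase a, (r.ρ (wordHolonomy U (xs b) (vs b))).trace) *
          ∑ k ∈ Finset.range (vs a).length, mergeTerm r.ρ s x μ U w (xs a) (vs a) k) * g U) ∂μW
        = ∫ U, ∑ i : Fin r.N, ∑ j : Fin r.N,
            ((Matrix.single j i (1 : ℂ) * insDeriv r.ρ (x, μ) (unitDir s i j) U x w).trace *
                (∏ a, (r.ρ (wordHolonomy U (xs a) (vs a))).trace) +
              (Matrix.single j i (1 : ℂ) * r.ρ (wordHolonomy U x w)).trace *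
                ∑ a, (∏ b ∈ Finset.univ.erase a, (r.ρ (wordHolonomy U (xs b) (vs b))).trace) *
                  (insDeriv r.ρ (x, μ) (unitDir s i j) U (xs a) (vs a)).trace) * g U ∂μW :=
          integral_congr_ae (ae_of_all _ fun U => (hL U).symm)
      _ = ∑ i : Fin r.N, ∑ j : Fin r.N, ∫ U,
            ((Matrix.single j i (1 : ℂ) * insDeriv r.ρ (x, μ) (unitDir s i j) U x w).trace *
                (∏ a, (r.ρ (wordHolonomy U (xs a) (vs a))).trace) +
              (Matrix.single j i (1 : ℂ) * r.ρ (wordHolonomy U x w)).trace *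
                ∑ a, (∏ b ∈ Finset.univ.erase a, (r.ρ (wordHolonomy U (xs b) (vs b))).trace) *
                  (insDeriv r.ρ (x, μ) (unitDir s i j) U (xs a) (vs a)).trace) * g U ∂μW := by
          rw [integral_finsetSum _ fun i _ => integrable_finsetSum _ fun j _ => hf i j]
          exact Finset.sum_congr rfl fun i _ => integral_finsetSum _ fun j _ => hf i j
      _ = ∑ i : Fin r.N, ∑ j : Fin r.N, (β : ℂ) * ∫ U, (Matrix.single j i (1 : ℂ) * r.ρ (wordHolonomy U x w)).trace *
            (∏ a, (r.ρ (wordHolonomy U (xs a) (vs a))).trace) * g U * (-(1 / 2) * plaqIns r.ρ (unitDir s i j) U x μ) ∂μW :=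
          Finset.sum_congr rfl fun i _ => Finset.sum_congr rfl fun j _ => hP i j (Matrix.single j i 1)
      _ = (β : ℂ) * ∑ i : Fin r.N, ∑ j : Fin r.N, ∫ U, (Matrix.single j i (1 : ℂ) * r.ρ (wordHolonomy U x w)).trace *
            (∏ a, (r.ρ (wordHolonomy U (xs a) (vs a))).trace) * g U * (-(1 / 2) * plaqIns r.ρ (unitDir s i j) U x μ) ∂μW := by
          simp only [Finset.mul_sum]
      _ = (β : ℂ) * ∫ U, ∑ i : Fin r.N, ∑ j : Fin r.N, (Matrix.single j i (1 : ℂ) * r.ρ (wordHolonomy U x w)).trace *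
            (∏ a, (r.ρ (wordHolonomy U (xs a) (vs a))).trace) * g U * (-(1 / 2) * plaqIns r.ρ (unitDir s i j) U x μ) ∂μW := by
          rw [integral_finsetSum _ fun i _ => integrable_finsetSum _ fun j _ => hg' i j]
          congr 1
          exact (Finset.sum_congr rfl fun i _ => integral_finsetSum _ fun j _ => hg' i j).symm
      _ = (β : ℂ) * ∫ U, (-(1 / 2) * ∑ ν ∈ Finset.univ.erase μ, ∑ ε : Bool, plaqTerm r.ρ s x μ U w ν ε) *
            ((∏ a, (r.ρ (wordHolonomy U (xs a) (vs a))).trace) * g U) ∂μW := by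
          congr 1
          exact integral_congr_ae (ae_of_all _ fun U => hR U)
  -- split the integrals into the stated sums
  have hi1 : ∀ k, Integrable (fun U => splitTerm r.ρ s x μ U w k *
      ((∏ a, (r.ρ (wordHolonomy U (xs a) (vs a))).trace) * g U)) μW :=
    fun k => integrable_of_continuous r β ((continuous_splitTerm r s x μ w k).mul (hcP.mul hg))
  have hi2 : ∀ a k, Integrable (fun U => (∏ b ∈ Finset.univ.erase a, (r.ρ (wordHolonomy U (xs b) (vs b))).trace) *
      mergeTerm r.ρ s x μ U w (xs a) (vs a) k * g U) μW :=
    fun a k => integrable_of_continuous r β (((hcPe a).mul (continuous_mergeTerm r s x μ w (xs a) (vs a) k)).mul hg)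
  have hi3 : ∀ ν ε, Integrable (fun U => plaqTerm r.ρ s x μ U w ν ε *
      ((∏ a, (r.ρ (wordHolonomy U (xs a) (vs a))).trace) * g U)) μW :=
    fun ν ε => integrable_of_continuous r β ((continuous_plaqTerm r s x μ w ν ε).mul (hcP.mul hg))
  have e2 : ∀ U : GaugeConfig d L G,
      (∑ a, (∏ b ∈ Finset.univ.erase a, (r.ρ (wordHolonomy U (xs b) (vs b))).trace) *
        ∑ k ∈ Finset.range (vs a).length, mergeTerm r.ρ s x μ U w (xs a) (vs a) k) * g U =
      ∑ a, ∑ k ∈ Finset.range (vs a).length,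
        (∏ b ∈ Finset.univ.erase a, (r.ρ (wordHolonomy U (xs b) (vs b))).trace) *
          mergeTerm r.ρ s x μ U w (xs a) (vs a) k * g U := fun U => by
    rw [Finset.sum_mul]
    refine Finset.sum_congr rfl fun a _ => ?_
    rw [Finset.mul_sum, Finset.sum_mul]
  have h1 : ∫ U, ((∑ k ∈ Finset.range w.length, splitTerm r.ρ s x μ U w k) *
        ((∏ a, (r.ρ (wordHolonomy U (xs a) (vs a))).trace) * g U) +
      (∑ a, (∏ b ∈ Finset.univ.erase a, (r.ρ (wordHolonomy U (xs b) (vs b))).trace) *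
        ∑ k ∈ Finset.range (vs a).length, mergeTerm r.ρ s x μ U w (xs a) (vs a) k) * g U) ∂μW =
      (∑ k ∈ Finset.range w.length, ∫ U, splitTerm r.ρ s x μ U w k *
        ((∏ a, (r.ρ (wordHolonomy U (xs a) (vs a))).trace) * g U) ∂μW) +
      ∑ a, ∑ k ∈ Finset.range (vs a).length,
        ∫ U, (∏ b ∈ Finset.univ.erase a, (r.ρ (wordHolonomy U (xs b) (vs b))).trace) *
          mergeTerm r.ρ s x μ U w (xs a) (vs a) k * g U ∂μW := by
    simp_rw [e2, Finset.sum_mul]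
    rw [integral_add (integrable_finsetSum _ fun k _ => hi1 k)
      (integrable_finsetSum _ fun a _ => integrable_finsetSum _ fun k _ => hi2 a k),
      integral_finsetSum _ fun k _ => hi1 k,
      integral_finsetSum _ fun a _ => integrable_finsetSum _ fun k _ => hi2 a k]
    congr 1
    exact Finset.sum_congr rfl fun a _ => integral_finsetSum _ fun k _ => hi2 a k
  have h2 : ∫ U, (-(1 / 2) * ∑ ν ∈ Finset.univ.erase μ, ∑ ε : Bool, plaqTerm r.ρ s x μ U w ν ε) *
      ((∏ a, (r.ρ (wordHolonomy U (xs a) (vs a))).trace) * g U) ∂μW =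
      -(1 / 2) * ∑ ν ∈ Finset.univ.erase μ, ∑ ε : Bool,
        ∫ U, plaqTerm r.ρ s x μ U w ν ε * ((∏ a, (r.ρ (wordHolonomy U (xs a) (vs a))).trace) * g U) ∂μW := by
    have : ∀ U : GaugeConfig d L G, (-(1 / 2) * ∑ ν ∈ Finset.univ.erase μ, ∑ ε : Bool, plaqTerm r.ρ s x μ U w ν ε) *
        ((∏ a, (r.ρ (wordHolonomy U (xs a) (vs a))).trace) * g U) = -(1 / 2) * ∑ ν ∈ Finset.univ.erase μ, ∑ ε : Bool,
          plaqTerm r.ρ s x μ U w ν ε * ((∏ a, (r.ρ (wordHolonomy U (xs a) (vs a))).trace) * g U) := fun U => by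
      rw [mul_assoc, Finset.sum_mul]
      congr 1
      exact Finset.sum_congr rfl fun ν _ => Finset.sum_mul _ _ _
    simp_rw [this]
    rw [integral_const_mul]
    congr 1
    rw [integral_finsetSum _ fun ν _ => integrable_finsetSum _ fun ε _ => hi3 ν ε]
    exact Finset.sum_congr rfl fun ν _ => integral_finsetSum _ fun ε _ => hi3 ν ε
  rw [h1, h2] at hsum
  linear_combination hsum

end Assembly

/-! ## `SU(N)` and `U(N)` -/

section Concrete

open Literature.MathematicalPhysics.QuantumLattice

/-- **`SU(N)`: every traceless direction satisfies the many-spectator pair identity** (multiplier ignoring the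
link). [folklore] -/
theorem sdPairMany_specialUnitaryGroup [NeZero L] (N : ℕ) (β : ℝ) (x : Site d L) (μ : Fin d) (x₀ : Site d L)
    (w : Word d) (xs : ι → Site d L) (vs : ι → Word d)
    {g : GaugeConfig d L (Matrix.specialUnitaryGroup (Fin N) ℂ) → ℂ} (hg : Continuous g)
    (hge : ∀ (U : GaugeConfig d L (Matrix.specialUnitaryGroup (Fin N) ℂ)) (h : Matrix.specialUnitaryGroup (Fin N) ℂ),
      g (Function.update U (x, μ) h) = g U)
    (X : Matrix (Fin N) (Fin N) ℂ) (hX : X.trace = 0) :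
    SDPairMany (fundamentalLatticeRep N) β x μ x₀ w xs vs g X := by
  refine sdPairMany_of_traceless (fundamentalLatticeRep N) β x μ x₀ w xs vs hg (fun X hXs hX0 => ?_) X hX
  have hmem := mem_oneParamGenerators_specialUnitaryGroup (n := Fin N) (X := X) hXs hX0
  refine sdPairMany_of_oneParam (fundamentalLatticeRep N) β x μ x₀ w xs vs hg hge hXs
    (k := fun t => ⟨NormedSpace.exp (t • X), hmem t⟩) (fun a b => Subtype.ext ?_) (fun t => ?_)
  · change NormedSpace.exp ((a + b) • X) = NormedSpace.exp (a • X) * NormedSpace.exp (b • X)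
    rw [add_smul]
    exact Matrix.exp_add_of_commute _ _ (((Commute.refl X).smul_left a).smul_right b)
  · change NormedSpace.exp (t • X) = NormedSpace.exp ((t : ℂ) • X)
    rw [Complex.coe_smul]

/-- **`U(N)`: every direction satisfies the many-spectator pair identity** (multiplier ignoring the link).
[folklore] -/
theorem sdPairMany_unitaryGroup [NeZero L] (N : ℕ) (β : ℝ) (x : Site d L) (μ : Fin d) (x₀ : Site d L) (w : Word d)
    (xs : ι → Site d L) (vs : ι → Word d)
    {g : GaugeConfig d L (Matrix.unitaryGroup (Fin N) ℂ) → ℂ} (hg : Continuous g)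
    (hge : ∀ (U : GaugeConfig d L (Matrix.unitaryGroup (Fin N) ℂ)) (h : Matrix.unitaryGroup (Fin N) ℂ),
      g (Function.update U (x, μ) h) = g U)
    (X : Matrix (Fin N) (Fin N) ℂ) : SDPairMany (unitaryFundamentalLatticeRep N) β x μ x₀ w xs vs g X := by
  refine sdPairMany_of_skew (unitaryFundamentalLatticeRep N) β x μ x₀ w xs vs hg (fun X hXs => ?_) X
  have hmem := mem_oneParamGenerators_unitaryGroup (n := Fin N) (X := X) hXs
  refine sdPairMany_of_oneParam (unitaryFundamentalLatticeRep N) β x μ x₀ w xs vs hg hge hXs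
    (k := fun t => ⟨NormedSpace.exp (t • X), hmem t⟩) (fun a b => Subtype.ext ?_) (fun t => ?_)
  · change NormedSpace.exp ((a + b) • X) = NormedSpace.exp (a • X) * NormedSpace.exp (b • X)
    rw [add_smul]
    exact Matrix.exp_add_of_commute _ _ (((Commute.refl X).smul_left a).smul_right b)
  · change NormedSpace.exp (t • X) = NormedSpace.exp ((t : ℂ) • X)
    rw [Complex.coe_smul]

/-- ★★★ **THE MULTI-TRACE LOOP EQUATION FOR LATTICE `SU(N)` YANG–MILLS** (Wilson action, torus `(ℤ/L)^d`, any `d, L ≥ 1`,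
any real `β`; `s = 1`): for every edge `e = (x, μ)`, every word `w` closed at `x`, every finite family of spectator words
`v_a` from `x_a` and every continuous multiplier `g` ignoring `e`:
`Σ_k E[splitTerm_k(w)·Π_a tr hol v_a·g] + Σ_a Σ_{k'} E[(Π_{b≠a} tr hol v_b)·mergeTerm_{k'}(w, v_a)·g]
 + (β/2)·Σ_{ν≠μ,ε} E[plaqTerm_{ν,ε}(w)·Π_a tr hol v_a·g] = 0`. [folklore] -/
theorem loopEquationMany_specialUnitaryGroup [NeZero L] (N : ℕ) (β : ℝ) (x : Site d L) (μ : Fin d) (w : Word d)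
    (hw : Word.endpoint x w = x) (xs : ι → Site d L) (vs : ι → Word d)
    {g : GaugeConfig d L (Matrix.specialUnitaryGroup (Fin N) ℂ) → ℂ} (hg : Continuous g)
    (hge : ∀ (U : GaugeConfig d L (Matrix.specialUnitaryGroup (Fin N) ℂ)) (h : Matrix.specialUnitaryGroup (Fin N) ℂ),
      g (Function.update U (x, μ) h) = g U) :
    (∑ k ∈ Finset.range w.length, ∫ U, splitTerm (fundamentalRep (Fin N)) 1 x μ U w k *
        ((∏ a, (fundamentalRep (Fin N) (wordHolonomy U (xs a) (vs a))).trace) * g U)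
          ∂(wilsonMeasure (d := d) (L := L) (fundamentalRep (Fin N)) β)) +
      (∑ a, ∑ k ∈ Finset.range (vs a).length,
        ∫ U, (∏ b ∈ Finset.univ.erase a, (fundamentalRep (Fin N) (wordHolonomy U (xs b) (vs b))).trace) *
          mergeTerm (fundamentalRep (Fin N)) 1 x μ U w (xs a) (vs a) k * g U
            ∂(wilsonMeasure (d := d) (L := L) (fundamentalRep (Fin N)) β)) +
      (β / 2 : ℂ) * ∑ ν ∈ Finset.univ.erase μ, ∑ ε : Bool,
        ∫ U, plaqTerm (fundamentalRep (Fin N)) 1 x μ U w ν ε *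
          ((∏ a, (fundamentalRep (Fin N) (wordHolonomy U (xs a) (vs a))).trace) * g U)
            ∂(wilsonMeasure (d := d) (L := L) (fundamentalRep (Fin N)) β) = 0 :=
  loopEquationMany_of_sdPairMany (fundamentalLatticeRep N) β x μ 1 w hw xs vs hg
    fun i j => sdPairMany_specialUnitaryGroup N β x μ x w xs vs hg hge _ (trace_unitDir_one i j)

/-- ★★★ **THE MULTI-TRACE LOOP EQUATION FOR LATTICE `U(N)`** (`s = 0`: no `1/N` terms). [folklore] -/
theorem loopEquationMany_unitaryGroup [NeZero L] (N : ℕ) (β : ℝ) (x : Site d L) (μ : Fin d) (w : Word d)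
    (hw : Word.endpoint x w = x) (xs : ι → Site d L) (vs : ι → Word d)
    {g : GaugeConfig d L (Matrix.unitaryGroup (Fin N) ℂ) → ℂ} (hg : Continuous g)
    (hge : ∀ (U : GaugeConfig d L (Matrix.unitaryGroup (Fin N) ℂ)) (h : Matrix.unitaryGroup (Fin N) ℂ),
      g (Function.update U (x, μ) h) = g U) :
    (∑ k ∈ Finset.range w.length, ∫ U, splitTerm (unitaryFundamentalRep (Fin N) ℂ) 0 x μ U w k *
        ((∏ a, (unitaryFundamentalRep (Fin N) ℂ (wordHolonomy U (xs a) (vs a))).trace) * g U)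
          ∂(wilsonMeasure (d := d) (L := L) (unitaryFundamentalRep (Fin N) ℂ) β)) +
      (∑ a, ∑ k ∈ Finset.range (vs a).length,
        ∫ U, (∏ b ∈ Finset.univ.erase a, (unitaryFundamentalRep (Fin N) ℂ (wordHolonomy U (xs b) (vs b))).trace) *
          mergeTerm (unitaryFundamentalRep (Fin N) ℂ) 0 x μ U w (xs a) (vs a) k * g U
            ∂(wilsonMeasure (d := d) (L := L) (unitaryFundamentalRep (Fin N) ℂ) β)) +
      (β / 2 : ℂ) * ∑ ν ∈ Finset.univ.erase μ, ∑ ε : Bool,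
        ∫ U, plaqTerm (unitaryFundamentalRep (Fin N) ℂ) 0 x μ U w ν ε *
          ((∏ a, (unitaryFundamentalRep (Fin N) ℂ (wordHolonomy U (xs a) (vs a))).trace) * g U)
            ∂(wilsonMeasure (d := d) (L := L) (unitaryFundamentalRep (Fin N) ℂ) β) = 0 :=
  loopEquationMany_of_sdPairMany (unitaryFundamentalLatticeRep N) β x μ 0 w hw xs vs hg
    fun _ _ => sdPairMany_unitaryGroup N β x μ x w xs vs hg hge _

end Concrete

/-! ## Two spectators: the three-word loop equation written out -/

section ThreeWords

/-- `univ.erase 1 = {0}` in `Finset (Fin 2)`. [folklore] -/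
theorem univ_fin_two_erase_one : (Finset.univ : Finset (Fin 2)).erase 1 = {0} := by decide

variable [TopologicalSpace G] [IsTopologicalGroup G] [CompactSpace G] [MeasurableSpace G] [BorelSpace G]
  (r : LatticeRep G)

/-- ★★ **THE THREE-WORD LOOP EQUATION (abstract form)**: the marked word `w` (closed at `x`) with TWO spectators `v₁`
(from `x₁`) and `v₂` (from `x₂`), as the `Bool`-indexed instance of `loopEquationMany_of_sdPairMany` with trivial
multiplier:
`Σ_k E[splitTerm_k(w)·tr v₁·tr v₂] + Σ_{k'} E[tr v₂·mergeTerm_{k'}(w,v₁)] + Σ_{k'} E[tr v₁·mergeTerm_{k'}(w,v₂)]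
 + (β/2)ΣΣ E[plaqTerm(w)·tr v₁·tr v₂] = 0`. [folklore] -/
theorem loopEquation₃_of_sdPairMany [NeZero L] (β : ℝ) (x : Site d L) (μ : Fin d) (s : ℂ) (w : Word d)
    (hw : Word.endpoint x w = x) (x₁ : Site d L) (v₁ : Word d) (x₂ : Site d L) (v₂ : Word d)
    (hP : ∀ i j : Fin r.N, SDPairMany r β x μ x w ![x₁, x₂] ![v₁, v₂] (fun _ => (1 : ℂ)) (unitDir s i j)) :
    (∑ k ∈ Finset.range w.length, ∫ U, splitTerm r.ρ s x μ U w k *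
        ((r.ρ (wordHolonomy U x₁ v₁)).trace * (r.ρ (wordHolonomy U x₂ v₂)).trace) ∂(wilsonMeasure (d := d) (L := L) r.ρ β)) +
      (∑ k ∈ Finset.range v₁.length, ∫ U, (r.ρ (wordHolonomy U x₂ v₂)).trace * mergeTerm r.ρ s x μ U w x₁ v₁ k
        ∂(wilsonMeasure (d := d) (L := L) r.ρ β)) +
      (∑ k ∈ Finset.range v₂.length, ∫ U, (r.ρ (wordHolonomy U x₁ v₁)).trace * mergeTerm r.ρ s x μ U w x₂ v₂ k
        ∂(wilsonMeasure (d := d) (L := L) r.ρ β)) +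
      (β / 2 : ℂ) * ∑ ν ∈ Finset.univ.erase μ, ∑ ε : Bool, ∫ U, plaqTerm r.ρ s x μ U w ν ε *
        ((r.ρ (wordHolonomy U x₁ v₁)).trace * (r.ρ (wordHolonomy U x₂ v₂)).trace) ∂(wilsonMeasure (d := d) (L := L) r.ρ β) = 0 := by
  have h := loopEquationMany_of_sdPairMany r β x μ s w hw ![x₁, x₂] ![v₁, v₂] (g := fun _ => (1 : ℂ)) continuous_const hP
  simp only [Fin.prod_univ_two, Fin.sum_univ_two, Matrix.cons_val_zero, Matrix.cons_val_one,
    univ_erase_zero_fin_two, univ_fin_two_erase_one, Finset.prod_singleton, mul_one] at h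
  linear_combination h

open Literature.MathematicalPhysics.QuantumLattice in
/-- ★★ **THE THREE-WORD LOOP EQUATION FOR LATTICE `SU(N)`** (every edge `(x, μ)`, `w` closed at `x`, any two spectators,
every torus, every real `β`). [folklore] -/
theorem loopEquation₃_specialUnitaryGroup [NeZero L] (N : ℕ) (β : ℝ) (x : Site d L) (μ : Fin d) (w : Word d)
    (hw : Word.endpoint x w = x) (x₁ : Site d L) (v₁ : Word d) (x₂ : Site d L) (v₂ : Word d) :
    (∑ k ∈ Finset.range w.length, ∫ U, splitTerm (fundamentalRep (Fin N)) 1 x μ U w k *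
        ((fundamentalRep (Fin N) (wordHolonomy U x₁ v₁)).trace * (fundamentalRep (Fin N) (wordHolonomy U x₂ v₂)).trace)
          ∂(wilsonMeasure (d := d) (L := L) (fundamentalRep (Fin N)) β)) +
      (∑ k ∈ Finset.range v₁.length, ∫ U, (fundamentalRep (Fin N) (wordHolonomy U x₂ v₂)).trace *
        mergeTerm (fundamentalRep (Fin N)) 1 x μ U w x₁ v₁ k ∂(wilsonMeasure (d := d) (L := L) (fundamentalRep (Fin N)) β)) +
      (∑ k ∈ Finset.range v₂.length, ∫ U, (fundamentalRep (Fin N) (wordHolonomy U x₁ v₁)).trace *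
        mergeTerm (fundamentalRep (Fin N)) 1 x μ U w x₂ v₂ k ∂(wilsonMeasure (d := d) (L := L) (fundamentalRep (Fin N)) β)) +
      (β / 2 : ℂ) * ∑ ν ∈ Finset.univ.erase μ, ∑ ε : Bool, ∫ U, plaqTerm (fundamentalRep (Fin N)) 1 x μ U w ν ε *
        ((fundamentalRep (Fin N) (wordHolonomy U x₁ v₁)).trace * (fundamentalRep (Fin N) (wordHolonomy U x₂ v₂)).trace)
          ∂(wilsonMeasure (d := d) (L := L) (fundamentalRep (Fin N)) β) = 0 :=
  loopEquation₃_of_sdPairMany (fundamentalLatticeRep N) β x μ 1 w hw x₁ v₁ x₂ v₂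
    fun i j => sdPairMany_specialUnitaryGroup N β x μ x w _ _ continuous_const (fun _ _ => rfl) _ (trace_unitDir_one i j)

open Literature.MathematicalPhysics.QuantumLattice in
/-- ★★ **THE THREE-WORD LOOP EQUATION FOR LATTICE `U(N)`** (`s = 0`). [folklore] -/
theorem loopEquation₃_unitaryGroup [NeZero L] (N : ℕ) (β : ℝ) (x : Site d L) (μ : Fin d) (w : Word d)
    (hw : Word.endpoint x w = x) (x₁ : Site d L) (v₁ : Word d) (x₂ : Site d L) (v₂ : Word d) :
    (∑ k ∈ Finset.range w.length, ∫ U, splitTerm (unitaryFundamentalRep (Fin N) ℂ) 0 x μ U w k *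
        ((unitaryFundamentalRep (Fin N) ℂ (wordHolonomy U x₁ v₁)).trace *
          (unitaryFundamentalRep (Fin N) ℂ (wordHolonomy U x₂ v₂)).trace)
          ∂(wilsonMeasure (d := d) (L := L) (unitaryFundamentalRep (Fin N) ℂ) β)) +
      (∑ k ∈ Finset.range v₁.length, ∫ U, (unitaryFundamentalRep (Fin N) ℂ (wordHolonomy U x₂ v₂)).trace *
        mergeTerm (unitaryFundamentalRep (Fin N) ℂ) 0 x μ U w x₁ v₁ k
          ∂(wilsonMeasure (d := d) (L := L) (unitaryFundamentalRep (Fin N) ℂ) β)) +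
      (∑ k ∈ Finset.range v₂.length, ∫ U, (unitaryFundamentalRep (Fin N) ℂ (wordHolonomy U x₁ v₁)).trace *
        mergeTerm (unitaryFundamentalRep (Fin N) ℂ) 0 x μ U w x₂ v₂ k
          ∂(wilsonMeasure (d := d) (L := L) (unitaryFundamentalRep (Fin N) ℂ) β)) +
      (β / 2 : ℂ) * ∑ ν ∈ Finset.univ.erase μ, ∑ ε : Bool, ∫ U, plaqTerm (unitaryFundamentalRep (Fin N) ℂ) 0 x μ U w ν ε *
        ((unitaryFundamentalRep (Fin N) ℂ (wordHolonomy U x₁ v₁)).trace *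
          (unitaryFundamentalRep (Fin N) ℂ (wordHolonomy U x₂ v₂)).trace)
          ∂(wilsonMeasure (d := d) (L := L) (unitaryFundamentalRep (Fin N) ℂ) β) = 0 :=
  loopEquation₃_of_sdPairMany (unitaryFundamentalLatticeRep N) β x μ 0 w hw x₁ v₁ x₂ v₂
    fun _ _ => sdPairMany_unitaryGroup N β x μ x w _ _ continuous_const (fun _ _ => rfl) _

end ThreeWords

end Summit.QuantumFields.GaugeBoot


end
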